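import Mathlib

/-!
# Mean Jeffreys divergence of Jastrow slices (finite configuration space)

Soloist report `solo-AtomisticToContinuum-informed`, `paper/sharpest.md` §4.8, step (3) of
Theorem D (see `SoloInformedPositiveDefiniteJastrow`): for a symmetric `Ψ > 0` on `T^{n+1}`
with Jastrow slices `Ψ(x,Y) = F(Y) h(x) exp(-½ ∑ⱼ K(x,Yⱼ))`, `K` symmetric and positive
semi-definite on finite families with `K(x,x) ≤ κ`, and `η` the one-particle density of `Ψ²`,
the `Ψ²`-average over the environment `Y` of the Jeffreys divergence between `η` and the slice
density `p_Y = Ψ(·,Y)²/∑ₓΨ(x,Y)²` is at most `κ - ⟨η,Kη⟩ ≤ κ`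
(`SoloInformed.sum_jeffreys_le_of_posDef`). Ingredients: splitting of configuration sums,
exchangeability, and positive semi-definiteness of `K` on the signed measure
`∑ᵢ δ_{Xᵢ} - (n+1) η` [cite: Ruelle1969, §3.2].
-/

noncomputable section

open Finset

namespace Summit.AtomisticToContinuum.BoseEinsteinCondensation.Theorems

section Jastrow

variable {T : Type*} [Fintype T] [Nonempty T] {n : ℕ}

omit [Nonempty T] in
/-- Splitting a configuration sum into (first particle, the others). -/
theorem SoloInformed.sum_config_eq_sum_vecCons (Φ : (Fin (n + 1) → T) → ℝ) :
    ∑ X, Φ X = ∑ x : T, ∑ Y : Fin n → T, Φ (Matrix.vecCons x Y) := by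
  rw [← (Fin.consEquiv fun _ : Fin (n + 1) => T).sum_comp Φ, Fintype.sum_prod_type]
  rfl

omit [Nonempty T] in
/-- Relabelling the particles does not change a configuration sum. -/
theorem SoloInformed.sum_config_comp_perm (Φ : (Fin (n + 1) → T) → ℝ)
    (σ : Equiv.Perm (Fin (n + 1))) : ∑ X : Fin (n + 1) → T, Φ (X ∘ σ) = ∑ X, Φ X :=
  Fintype.sum_equiv (σ.symm.arrowCongr (Equiv.refl T)) _ _ fun X =>
    congrArg Φ (funext fun i => by simp [Equiv.arrowCongr_apply])

omit [Fintype T] [Nonempty T] in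
/-- A kernel that is positive semi-definite on every finite family indexed by `Fin m` is positive
semi-definite on every finite family. -/
theorem SoloInformed.posDef_sum_fintype {K : T → T → ℝ}
    (hK : ∀ (m : ℕ) (z : Fin m → T) (c : Fin m → ℝ), 0 ≤ ∑ i, ∑ j, c i * c j * K (z i) (z j))
    {ι : Type*} [Fintype ι] (z : ι → T) (c : ι → ℝ) :
    0 ≤ ∑ i, ∑ j, c i * c j * K (z i) (z j) := by
  classical
  have h := hK (Fintype.card ι) (z ∘ (Fintype.equivFin ι).symm) (c ∘ (Fintype.equivFin ι).symm)
  have h1 : ∑ i : Fin (Fintype.card ι), ∑ j : Fin (Fintype.card ι),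
      (c ∘ (Fintype.equivFin ι).symm) i * (c ∘ (Fintype.equivFin ι).symm) j *
        K ((z ∘ (Fintype.equivFin ι).symm) i) ((z ∘ (Fintype.equivFin ι).symm) j) =
      ∑ i, ∑ j, c i * c j * K (z i) (z j) := by
    rw [← (Fintype.equivFin ι).sum_comp]
    refine Finset.sum_congr rfl fun i _ => ?_
    rw [← (Fintype.equivFin ι).sum_comp]
    simp
  rw [h1] at h
  exact h

/-- **Mean Jeffreys divergence of the slices is at most the self-energy** (the heart of the
positive-definite Jastrow theorem). Setting: `Ψ > 0` symmetric on `T^{n+1}` with Jastrow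
slices `Ψ(x, Y) = F(Y) h(x) exp(-½ ∑ⱼ K(x, Yⱼ))`, `K` a symmetric positive semi-definite kernel
with diagonal `≤ κ`, `η` the one-particle density of `Ψ²`. With `S_Y = ∑ₓ Ψ(x,Y)²`,
`p_Y = Ψ(·,Y)²/S_Y` and `J_Y = ∑ₓ (η - p_Y)(log η - log p_Y)` (Jeffreys divergence):
`∑_Y S_Y J_Y ≤ κ ∑_X Ψ(X)²`, i.e. `E[J_Y] ≤ κ` (in fact `≤ κ - ⟨η, K η⟩`). Proof: the one-body
logarithms average out (`E p_Y = η`), leaving `E J = n⟨η,Kη⟩ - E ∑ⱼ K(X₀,Xⱼ)`, and positive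
semi-definiteness of `K` on the signed measure `∑ᵢ δ_{Xᵢ} - (n+1) η` bounds the pair sum from
below by `(n+1)⟨η,Kη⟩ - κ`. -/
theorem SoloInformed.sum_jeffreys_le_of_posDef
    (K : T → T → ℝ) (hKs : ∀ x y, K x y = K y x)
    (hK : ∀ (m : ℕ) (z : Fin m → T) (c : Fin m → ℝ), 0 ≤ ∑ i, ∑ j, c i * c j * K (z i) (z j))
    {κ : ℝ} (hκ : ∀ x, K x x ≤ κ)
    (h : T → ℝ) (hh : ∀ x, 0 < h x) (F : (Fin n → T) → ℝ) (hF : ∀ Y, 0 < F Y)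
    (Ψ : (Fin (n + 1) → T) → ℝ)
    (hsymm : ∀ (σ : Equiv.Perm (Fin (n + 1))) (X : Fin (n + 1) → T), Ψ (X ∘ σ) = Ψ X)
    (hslice : ∀ (x : T) (Y : Fin n → T),
      Ψ (Matrix.vecCons x Y) = F Y * (h x * Real.exp (-(1 / 2) * ∑ j, K x (Y j))))
    (η : T → ℝ) (hη : ∀ x, η x = (∑ Y : Fin n → T, Ψ (Matrix.vecCons x Y) ^ 2) / ∑ X, Ψ X ^ 2) :
    ∑ Y : Fin n → T, ∑ x, (η x * (∑ x', Ψ (Matrix.vecCons x' Y) ^ 2) -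
        Ψ (Matrix.vecCons x Y) ^ 2) * (Real.log (η x) - Real.log (Ψ (Matrix.vecCons x Y) ^ 2)) ≤
      κ * ∑ X, Ψ X ^ 2 := by
  have hsplit : ∀ Φ : (Fin (n + 1) → T) → ℝ,
      ∑ X, Φ X = ∑ x, ∑ Y, Φ (Matrix.vecCons x Y) := SoloInformed.sum_config_eq_sum_vecCons
  have hg : ∀ (x : T) (Y : Fin n → T), 0 < Ψ (Matrix.vecCons x Y) := fun x Y => by
    rw [hslice]; exact mul_pos (hF Y) (mul_pos (hh x) (Real.exp_pos _))
  obtain ⟨Z, hZ⟩ : ∃ r : ℝ, r = ∑ X, Ψ X ^ 2 := ⟨_, rfl⟩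
  rw [← hZ] at hη ⊢
  have hZ' : Z = ∑ x, ∑ Y : Fin n → T, Ψ (Matrix.vecCons x Y) ^ 2 := by
    rw [hZ]; exact hsplit fun X => Ψ X ^ 2
  have hZpos : 0 < Z := by
    rw [hZ']
    exact Finset.sum_pos (fun x _ => Finset.sum_pos (fun Y _ => pow_pos (hg x Y) 2)
      Finset.univ_nonempty) Finset.univ_nonempty
  -- one-particle marginal: `∑_Y Ψ(x,Y)² = η x · Z`
  have hmarg : ∀ x, ∑ Y : Fin n → T, Ψ (Matrix.vecCons x Y) ^ 2 = η x * Z := fun x => by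
    rw [hη, div_mul_cancel₀ _ hZpos.ne']
  have hη1 : ∑ x, η x = 1 := by
    have h1 : (∑ x, η x) * Z = 1 * Z := by
      rw [Finset.sum_mul, one_mul]
      calc ∑ x, η x * Z = ∑ x, ∑ Y : Fin n → T, Ψ (Matrix.vecCons x Y) ^ 2 :=
            Finset.sum_congr rfl fun x _ => (hmarg x).symm
        _ = Z := hZ'.symm
    exact mul_right_cancel₀ hZpos.ne' h1
  -- exchangeability: `E f(X_i) = E f(X_0)`
  have hexch : ∀ (f : T → ℝ) (i : Fin (n + 1)),
      ∑ X, Ψ X ^ 2 * f (X i) = ∑ X, Ψ X ^ 2 * f (X 0) := by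
    intro f i
    rw [← SoloInformed.sum_config_comp_perm (fun X => Ψ X ^ 2 * f (X i)) (Equiv.swap 0 i)]
    refine Finset.sum_congr rfl fun X _ => ?_
    simp only [Function.comp_apply, Equiv.swap_apply_right, hsymm]
  -- `E f(X_0) = Z · ∑ η f`
  have hfirst : ∀ f : T → ℝ, ∑ X, Ψ X ^ 2 * f (X 0) = Z * ∑ x, η x * f x := by
    intro f
    rw [hsplit (fun X => Ψ X ^ 2 * f (X 0))]
    simp only [Matrix.cons_val_zero]
    rw [Finset.mul_sum]
    refine Finset.sum_congr rfl fun x _ => ?_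
    rw [← Finset.sum_mul, hmarg]
    ring
  -- the smeared kernel `Kη` and the quadratic form `q = ⟨η, K η⟩ ≥ 0`
  obtain ⟨Kη, hKη⟩ : ∃ f : T → ℝ, f = fun y => ∑ x, η x * K x y := ⟨_, rfl⟩
  obtain ⟨q, hq⟩ : ∃ r : ℝ, r = ∑ y, η y * Kη y := ⟨_, rfl⟩
  have hq0 : 0 ≤ q := by
    have h0 := SoloInformed.posDef_sum_fintype hK id η
    rw [hq, hKη]
    simp only [Finset.mul_sum]
    calc (0 : ℝ) ≤ ∑ i, ∑ j, η i * η j * K (id i) (id j) := h0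
      _ = ∑ y, ∑ x, η y * (η x * K x y) :=
          Finset.sum_congr rfl fun y _ => Finset.sum_congr rfl fun x _ => by
            rw [id, id, hKs y x]; ring
  -- (E1)  `∑_Y S_Y ∑ₓ η(x) W_Y(x) = n · Z · q`
  obtain ⟨E', hE'⟩ : ∃ r : ℝ, r = ∑ X, Ψ X ^ 2 * ∑ j : Fin n, K (X 0) (X j.succ) := ⟨_, rfl⟩
  have hE1 : ∑ Y : Fin n → T, (∑ x', Ψ (Matrix.vecCons x' Y) ^ 2) *
      ∑ x, η x * ∑ j, K x (Y j) = n * (Z * q) := by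
    have h1 : ∀ Y : Fin n → T, ∑ x, η x * ∑ j, K x (Y j) = ∑ j, Kη (Y j) := fun Y => by
      rw [hKη]
      simp only [Finset.mul_sum]
      exact Finset.sum_comm
    have h2 : ∀ j : Fin n,
        ∑ Y : Fin n → T, (∑ x', Ψ (Matrix.vecCons x' Y) ^ 2) * Kη (Y j) = Z * q := fun j => by
      calc ∑ Y : Fin n → T, (∑ x', Ψ (Matrix.vecCons x' Y) ^ 2) * Kη (Y j)
          = ∑ Y : Fin n → T, ∑ x', Ψ (Matrix.vecCons x' Y) ^ 2 * Kη (Y j) :=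
            Finset.sum_congr rfl fun Y _ => Finset.sum_mul _ _ _
        _ = ∑ x', ∑ Y : Fin n → T, Ψ (Matrix.vecCons x' Y) ^ 2 * Kη (Y j) := Finset.sum_comm
        _ = ∑ X, Ψ X ^ 2 * Kη (X j.succ) := by
            rw [hsplit (fun X => Ψ X ^ 2 * Kη (X j.succ))]
            simp only [Matrix.cons_val_succ]
        _ = ∑ X, Ψ X ^ 2 * Kη (X 0) := hexch Kη j.succ
        _ = Z * q := by rw [hfirst Kη, hq]
    calc ∑ Y : Fin n → T, (∑ x', Ψ (Matrix.vecCons x' Y) ^ 2) * ∑ x, η x * ∑ j, K x (Y j)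
        = ∑ Y : Fin n → T, ∑ j, (∑ x', Ψ (Matrix.vecCons x' Y) ^ 2) * Kη (Y j) := by
          refine Finset.sum_congr rfl fun Y _ => ?_
          rw [h1 Y, Finset.mul_sum]
      _ = ∑ j : Fin n, ∑ Y : Fin n → T, (∑ x', Ψ (Matrix.vecCons x' Y) ^ 2) * Kη (Y j) :=
          Finset.sum_comm
      _ = ∑ j : Fin n, Z * q := Finset.sum_congr rfl fun j _ => h2 j
      _ = n * (Z * q) := by
          rw [Finset.sum_const, Finset.card_univ, Fintype.card_fin, nsmul_eq_mul]
  -- (E2)  `∑_Y ∑ₓ Ψ(x,Y)² W_Y(x) = E'`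
  have hE2 : ∑ Y : Fin n → T, ∑ x, Ψ (Matrix.vecCons x Y) ^ 2 * ∑ j, K x (Y j) = E' := by
    rw [hE', hsplit (fun X => Ψ X ^ 2 * ∑ j : Fin n, K (X 0) (X j.succ))]
    simp only [Matrix.cons_val_zero, Matrix.cons_val_succ]
    exact Finset.sum_comm
  -- (E3)  positive semi-definiteness on `∑ᵢ δ_{Xᵢ} - (n+1) η`
  have hpsd : ∀ X : Fin (n + 1) → T,
      0 ≤ ∑ i, ∑ j, K (X i) (X j) - 2 * (n + 1) * ∑ i, Kη (X i) + (n + 1) ^ 2 * q := by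
    intro X
    have h0 := SoloInformed.posDef_sum_fintype hK (Sum.elim X (fun y => y))
      (Sum.elim (fun _ => (1 : ℝ)) (fun y => -((n + 1 : ℝ) * η y)))
    rw [Fintype.sum_sum_type] at h0
    simp only [Fintype.sum_sum_type, Sum.elim_inl, Sum.elim_inr] at h0
    rw [Finset.sum_add_distrib, Finset.sum_add_distrib] at h0
    simp only [one_mul, mul_one] at h0
    -- identify the two cross terms and the `η ⊗ η` term
    have hc2 : ∑ i : Fin (n + 1), ∑ y, -((n + 1 : ℝ) * η y) * K (X i) y =
        -((n + 1) * ∑ i, Kη (X i)) := by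
      rw [hKη, Finset.mul_sum, ← Finset.sum_neg_distrib]
      refine Finset.sum_congr rfl fun i _ => ?_
      simp only [Finset.mul_sum, ← Finset.sum_neg_distrib]
      refine Finset.sum_congr rfl fun y _ => ?_
      rw [hKs (X i) y]
      ring
    have hc3 : ∑ y, ∑ j : Fin (n + 1), -((n + 1 : ℝ) * η y) * K y (X j) =
        -((n + 1) * ∑ i, Kη (X i)) := by
      rw [hKη, Finset.sum_comm, Finset.mul_sum, ← Finset.sum_neg_distrib]
      refine Finset.sum_congr rfl fun i _ => ?_
      simp only [Finset.mul_sum, ← Finset.sum_neg_distrib]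
      exact Finset.sum_congr rfl fun y _ => by ring
    have hc4 : ∑ y, ∑ y', -((n + 1 : ℝ) * η y) * -((n + 1 : ℝ) * η y') * K y y' =
        (n + 1) ^ 2 * q := by
      rw [hq, hKη, Finset.mul_sum, Finset.sum_comm]
      refine Finset.sum_congr rfl fun y' _ => ?_
      simp only [Finset.mul_sum]
      exact Finset.sum_congr rfl fun y _ => by rw [hKs y y']; ring
    rw [hc2, hc3, hc4] at h0
    linarith
  -- sum `Ψ² ·` (E3) over configurations
  have hdiag : ∑ X, Ψ X ^ 2 * ∑ i, K (X i) (X i) ≤ (n + 1) * κ * Z := by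
    calc ∑ X, Ψ X ^ 2 * ∑ i, K (X i) (X i) ≤ ∑ X, Ψ X ^ 2 * ((n + 1) * κ) := by
          refine Finset.sum_le_sum fun X _ => mul_le_mul_of_nonneg_left ?_ (sq_nonneg _)
          calc ∑ i, K (X i) (X i) ≤ ∑ _i : Fin (n + 1), κ := Finset.sum_le_sum fun i _ => hκ (X i)
            _ = (n + 1) * κ := by
                rw [Finset.sum_const, Finset.card_univ, Fintype.card_fin, nsmul_eq_mul,
                  Nat.cast_add, Nat.cast_one]
      _ = (n + 1) * κ * Z := by rw [← Finset.sum_mul, ← hZ]; ring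
  have hoff : ∀ i : Fin (n + 1), ∑ X, Ψ X ^ 2 * (∑ j, K (X i) (X j) - K (X i) (X i)) = E' := by
    intro i
    rw [hE', ← SoloInformed.sum_config_comp_perm
      (fun X => Ψ X ^ 2 * (∑ j, K (X i) (X j) - K (X i) (X i))) (Equiv.swap 0 i)]
    refine Finset.sum_congr rfl fun X _ => ?_
    simp only [Function.comp_apply, Equiv.swap_apply_right, hsymm]
    have hs : ∑ j, K (X 0) (X (Equiv.swap 0 i j)) = ∑ j, K (X 0) (X j) :=
      Equiv.sum_comp (Equiv.swap 0 i) (fun j => K (X 0) (X j))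
    rw [hs, Fin.sum_univ_succ]
    ring
  have hpair : ∑ X, Ψ X ^ 2 * ∑ i, ∑ j, K (X i) (X j) =
      ∑ X, Ψ X ^ 2 * ∑ i, K (X i) (X i) + (n + 1) * E' := by
    have h1 : ∀ X : Fin (n + 1) → T, Ψ X ^ 2 * ∑ i, ∑ j, K (X i) (X j) =
        Ψ X ^ 2 * ∑ i, K (X i) (X i) + ∑ i, Ψ X ^ 2 * (∑ j, K (X i) (X j) - K (X i) (X i)) := by
      intro X
      rw [← Finset.mul_sum, Finset.sum_sub_distrib]
      ring
    rw [Finset.sum_congr rfl fun X _ => h1 X, Finset.sum_add_distrib, Finset.sum_comm,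
      Finset.sum_congr rfl fun i _ => hoff i, Finset.sum_const, Finset.card_univ, Fintype.card_fin,
      nsmul_eq_mul, Nat.cast_add, Nat.cast_one]
  have hlin : ∑ X, Ψ X ^ 2 * ∑ i, Kη (X i) = (n + 1) * (Z * q) := by
    have h1 : ∀ i : Fin (n + 1), ∑ X, Ψ X ^ 2 * Kη (X i) = Z * q := fun i => by
      rw [hexch Kη i, hfirst Kη, hq]
    calc ∑ X, Ψ X ^ 2 * ∑ i, Kη (X i) = ∑ X, ∑ i, Ψ X ^ 2 * Kη (X i) :=
          Finset.sum_congr rfl fun X _ => Finset.mul_sum _ _ _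
      _ = ∑ i : Fin (n + 1), ∑ X, Ψ X ^ 2 * Kη (X i) := Finset.sum_comm
      _ = ∑ _i : Fin (n + 1), Z * q := Finset.sum_congr rfl fun i _ => h1 i
      _ = (n + 1) * (Z * q) := by
          rw [Finset.sum_const, Finset.card_univ, Fintype.card_fin, nsmul_eq_mul, Nat.cast_add,
            Nat.cast_one]
  have hsumP : 0 ≤ ∑ X, Ψ X ^ 2 *
      (∑ i, ∑ j, K (X i) (X j) - 2 * (n + 1) * ∑ i, Kη (X i) + (n + 1) ^ 2 * q) :=
    Finset.sum_nonneg fun X _ => mul_nonneg (sq_nonneg _) (hpsd X)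
  have hexp : ∑ X, Ψ X ^ 2 *
      (∑ i, ∑ j, K (X i) (X j) - 2 * (n + 1) * ∑ i, Kη (X i) + (n + 1) ^ 2 * q) =
      (∑ X, Ψ X ^ 2 * ∑ i, K (X i) (X i)) + (n + 1) * E' -
        2 * (n + 1) * ((n + 1) * (Z * q)) + (n + 1) ^ 2 * q * Z := by
    have h1 : ∀ X : Fin (n + 1) → T, Ψ X ^ 2 *
        (∑ i, ∑ j, K (X i) (X j) - 2 * (n + 1) * ∑ i, Kη (X i) + (n + 1) ^ 2 * q) =
        Ψ X ^ 2 * ∑ i, ∑ j, K (X i) (X j) - 2 * (n + 1) * (Ψ X ^ 2 * ∑ i, Kη (X i)) +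
          (n + 1) ^ 2 * q * Ψ X ^ 2 := fun X => by ring
    rw [Finset.sum_congr rfl fun X _ => h1 X, Finset.sum_add_distrib, Finset.sum_sub_distrib,
      ← Finset.mul_sum, ← Finset.mul_sum, hpair, hlin, ← hZ]
  have hEb : (n + 1) * Z * q - κ * Z ≤ E' := by
    rw [hexp] at hsumP
    have h3 : (n + 1 : ℝ) * 0 ≤ (n + 1) * (κ * Z + E' - (n + 1) * Z * q) := by
      rw [mul_zero]
      nlinarith [hsumP, hdiag]
    have h4 := le_of_mul_le_mul_left h3 (by positivity : (0 : ℝ) < n + 1)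
    linarith
  -- the logarithm of a slice
  have hlog : ∀ (x : T) (Y : Fin n → T), Real.log (Ψ (Matrix.vecCons x Y) ^ 2) =
      2 * Real.log (F Y) + 2 * Real.log (h x) - ∑ j, K x (Y j) := by
    intro x Y
    rw [hslice, Real.log_pow, Real.log_mul (hF Y).ne' (mul_pos (hh x) (Real.exp_pos _)).ne',
      Real.log_mul (hh x).ne' (Real.exp_pos _).ne', Real.log_exp]
    push_cast
    ring
  -- (T2) the `log F` terms vanish slice by slice
  have hT2 : ∀ Y : Fin n → T, ∑ x, (η x * (∑ x', Ψ (Matrix.vecCons x' Y) ^ 2) -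
      Ψ (Matrix.vecCons x Y) ^ 2) * (2 * Real.log (F Y)) = 0 := by
    intro Y
    rw [← Finset.sum_mul, Finset.sum_sub_distrib, ← Finset.sum_mul, hη1, one_mul, sub_self,
      zero_mul]
  -- (T1) the one-body logarithms vanish after averaging over the environment
  have hT1 : ∑ Y : Fin n → T, ∑ x, (η x * (∑ x', Ψ (Matrix.vecCons x' Y) ^ 2) -
      Ψ (Matrix.vecCons x Y) ^ 2) * (Real.log (η x) - 2 * Real.log (h x)) = 0 := by
    rw [Finset.sum_comm]
    refine Finset.sum_eq_zero fun x _ => ?_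
    rw [← Finset.sum_mul, Finset.sum_sub_distrib, ← Finset.mul_sum, hmarg x]
    have h1 : ∑ Y : Fin n → T, ∑ x', Ψ (Matrix.vecCons x' Y) ^ 2 = Z := by
      rw [hZ']
      exact Finset.sum_comm
    rw [h1, sub_self, zero_mul]
  -- (T3) the pair terms
  have hT3 : ∑ Y : Fin n → T, ∑ x, (η x * (∑ x', Ψ (Matrix.vecCons x' Y) ^ 2) -
      Ψ (Matrix.vecCons x Y) ^ 2) * ∑ j, K x (Y j) = n * (Z * q) - E' := by
    rw [← hE1, ← hE2, ← Finset.sum_sub_distrib]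
    refine Finset.sum_congr rfl fun Y _ => ?_
    rw [Finset.mul_sum, ← Finset.sum_sub_distrib]
    refine Finset.sum_congr rfl fun x _ => ?_
    ring
  -- assemble
  calc ∑ Y : Fin n → T, ∑ x, (η x * (∑ x', Ψ (Matrix.vecCons x' Y) ^ 2) -
        Ψ (Matrix.vecCons x Y) ^ 2) * (Real.log (η x) - Real.log (Ψ (Matrix.vecCons x Y) ^ 2))
      = ∑ Y : Fin n → T, ∑ x, ((η x * (∑ x', Ψ (Matrix.vecCons x' Y) ^ 2) -
          Ψ (Matrix.vecCons x Y) ^ 2) * (Real.log (η x) - 2 * Real.log (h x)) -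
          (η x * (∑ x', Ψ (Matrix.vecCons x' Y) ^ 2) - Ψ (Matrix.vecCons x Y) ^ 2) *
            (2 * Real.log (F Y)) +
          (η x * (∑ x', Ψ (Matrix.vecCons x' Y) ^ 2) - Ψ (Matrix.vecCons x Y) ^ 2) *
            ∑ j, K x (Y j)) := by
        refine Finset.sum_congr rfl fun Y _ => Finset.sum_congr rfl fun x _ => ?_
        rw [hlog x Y]
        ring
    _ = 0 - 0 + (n * (Z * q) - E') := by
        simp only [Finset.sum_add_distrib, Finset.sum_sub_distrib]
        rw [hT1, Finset.sum_eq_zero fun Y _ => hT2 Y, hT3]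
    _ ≤ κ * Z := by nlinarith [hEb, hq0, hZpos]

end Jastrow

end Summit.AtomisticToContinuum.BoseEinsteinCondensation.Theorems

end
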